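import Summits.BirchSwinnertonDyer.Rank1Residual.X2.GreenbergVatsalSelmerLink
import Literature.NumberTheory.EllipticCurves.TateUniformisation
import HarnessLib

/-!
# The Tate-curve datum `C_v = ι⁻¹Φ(μ(K̄_v))` at a multiplicative place, IN THE KERNEL: `D_v`-stability,
# GV's "`I_p` acts trivially on `D`" and the Kummer compatibility PROVED relative to a Tate
# parametrisation; hence `Sel_{p^∞}(E/K_∞) ⊆ S^{Σ₀}_{E[p^∞]}(K_∞)` at `p ‖ N` granted the published
# Tate uniformisation

HONEST FRAMING (cell `b2b-bsdres`, run/shared/lean/b2b/bsd-rank1-residual/, verbatim in every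
file): the goal of the cell is to DELETE the COMBINATION-SHAPED residual classes of the
Birch–Swinnerton-Dyer formula for ALL analytic-rank `≤ 1` elliptic curves over `ℚ` — "full BSD
formula for every rank `≤ 1` curve in class `C`" assembled STRICTLY from published theorems — so
that the rank-`≤ 1` remainder becomes exactly the CONSTRUCTION-SHAPED classes, which are TYPED
(missing-input `Prop`s), NOT attempted. This is not "finishing BSD". Sub-cell
`b2b-bsdres-eisenstein-p2` (CLASS-OWNERS row "X2"), gen 9: research route; NO CLAIM BEYOND STATED
CLASSES; nothing here changes a label. One definition with a body (`tateDatum`, Greenberg–Vatsal's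
own `C` at `p ‖ N`) and theorems; NO new named fact. §3–§4 are CONDITIONAL on the tree's named facts
`Silverman1994_thmV53_tateUniformisation` / `Silverman1994_thmV53_corV54_tateUniformisation`
(Silverman *ATAEC* V.3.1/V.5.2–V.5.4, PUBLISHED; taken as hypotheses `hT`); §1–§2 take the
parametrisation as explicit data and are unconditional.

GREENBERG–VATSAL pp. 14–15 (arXiv:math/9906215): at a prime `p ‖ N` the `G_{ℚ_p}`-module
`A = E[p^∞]` has the filtration `0 → C → A → D → 0` of the Tate curve, `C ≅ μ_{p^∞}` (twisted by the
unramified quadratic character in the non-split case), `D ≅ ℚ_p/ℤ_p(δ)` unramified, and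
`Sel_E(ℚ_∞)_p ⊆ S_A(ℚ_∞)` with `λ(S_A) = λ(Sel) + e_p`. THIS FILE: for a parametrisation
`Φ : K̄_v^* → E(K̄_v)` with kernel `q^ℤ` (`0 < |q|_v < 1`), surjective, `Γ_{K_v}`-equivariant up to
sign and equivariant on the inertia group:
* `tateDatum` — `C_v = {m ∈ E[p^∞] : ι m ∈ Φ(roots of unity)}` as a `GreenbergSelmer.LocalDatum`
  (`D_v`-stable);
* **`tateDatum_htriv`** — "`I_p` acts trivially on `D`": `x•m − m ∈ C_v` (`(σu/u)^{p^k} = σ(q^a)/q^a = 1`);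
* **`tateDatum_kummer`** — the Kummer compatibility of `GreenbergVatsalSelmerLink`: a torsion point
  `σP − P` (`σ ∈ I_{K_v}`, `P ∈ E(K̄_v)` arbitrary) lies in `C_v` (`|σu/u|_v = 1`, `|q|_v < 1`);
* `exists_datum_of_hasSplitMultiplicativeReductionAt` / `…_of_hasMultiplicativeReductionAt` — from
  the named facts (the non-split case displays `ht`: inertia fixes `√γ(E/K)`, i.e. `K_v(√γ)/K_v`
  unramified, Silverman *ATAEC* Ex. 5.11 — not vendored in the tree, so kept as a hypothesis);
* **`exists_data_selmerInfty_le_gvSelmerInfty_of_split`** (`…_of_multiplicative`) — the dual link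
  `WeierstrassCurve.selmerInfty κ ≤ gvSelmerInfty κ E[p^∞] L Σ₀` (referee R102.2 (b)) for the
  MULTIPLICATIVE member of a route-G pair, with Tate data satisfying GV's `htriv`.
WHAT STAYS PRINTED: `λ(S_A) = λ(Sel) + e_p` (GV pp. 14–15), Cor. (2.3)/Prop. (2.4)/(2.5), the
finiteness of `E(ℚ_∞)[p^∞]` at `p ‖ N`, and the Tate uniformisation itself.

References: Greenberg–Vatsal 2000, §2 pp. 14–15, 19; Silverman, *ATAEC* (GTM 151) Ch. V Thm. 3.1,
Lemma 5.2, Thm. 5.3, Cor. 5.4; Neukirch *ANT* II (4.8) (spectral valuation, Galois isometry).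
-/

noncomputable section

open scoped Classical AddSubgroup NNReal

open NumberField IsDedekindDomain Field
open Literature.NumberTheory.EllipticCurves Literature.NumberTheory.EllipticCurves.GreenbergSelmer
  Literature.NumberTheory.GaloisRepresentations IsDedekindDomain.HeightOneSpectrum
  Summit.BirchSwinnertonDyer.Rank1Residual.X2.GreenbergVatsalTorsion

universe u

namespace Summit.BirchSwinnertonDyer.Rank1Residual.X2.GreenbergVatsalTateDatum

variable {K : Type u} [Field K] [NumberField K] (W : WeierstrassCurve K) (p : ℕ)
  {v : HeightOneSpectrum (𝓞 K)}
  (Φ : Additive (AlgebraicClosure (v.adicCompletion K))ˣ →+ localPoints W (v.adicCompletion K))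

/-! ## §1. The datum `C_v = ι⁻¹ Φ(μ)` -/

section Datum

/-- **The Tate datum at a multiplicative place**: for a parametrisation
`Φ : K̄_v^* → E(K̄_v)` (Silverman *ATAEC* V.3.1/V.5.3: `Φ = ψ ∘ φ`, kernel `q^ℤ`) which is
`Γ_{K_v}`-equivariant UP TO SIGN (`hΦ`: `σ•Φ(u) = ±Φ(σu)` — the split case V.5.3 (b) has `+`, the
non-split case the quadratic twist of Lemma V.5.2 (c)), the subgroup
`C_v = {m ∈ E[p^∞] : ι m ∈ Φ(μ(K̄_v))}` of `p`-power torsion points parametrised by ROOTS OF UNITY —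
Greenberg–Vatsal's `C` at `p ‖ N` ("`C ≅ μ_{p^∞}` (twisted by an unramified quadratic character in the
non-split case), `D = A/C ≅ ℚ_p/ℤ_p(δ)`", pp. 14–15) — as a `GreenbergSelmer.LocalDatum`:
`D_v`-stable since `σ` maps roots of unity to roots of unity.
[cite: GreenbergVatsal2000, §2 pp. 14–15] [cite: SilvermanATAEC1994, Ch. V Thm. 3.1 (c),(d) and Thm. 5.3] -/
def tateDatum
    (hΦ : ∀ (σ : absoluteGaloisGroup (v.adicCompletion K))
      (u : (AlgebraicClosure (v.adicCompletion K))ˣ),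
      σ • Φ (Additive.ofMul u) = Φ (Additive.ofMul (Units.map
        (Field.absoluteGaloisGroup.toAlgEquiv (v.adicCompletion K) σ :
          AlgebraicClosure (v.adicCompletion K) →* AlgebraicClosure (v.adicCompletion K)) u)) ∨
      σ • Φ (Additive.ofMul u) = -Φ (Additive.ofMul (Units.map
        (Field.absoluteGaloisGroup.toAlgEquiv (v.adicCompletion K) σ :
          AlgebraicClosure (v.adicCompletion K) →* AlgebraicClosure (v.adicCompletion K)) u))) :
    LocalDatum K (W.geomPrimaryTorsion p) v where
  plus :=
    { carrier := {m | ∃ ζ : (AlgebraicClosure (v.adicCompletion K))ˣ, IsOfFinOrder ζ ∧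
        Φ (Additive.ofMul ζ) =
          ((pointsMap W (v.adicCompletion K)).comp (W.geomPrimaryTorsion p).subtype) m}
      zero_mem' := ⟨1, IsOfFinOrder.one, by rw [ofMul_one, map_zero, map_zero]⟩
      add_mem' := by
        rintro a b ⟨ζ, hζ, ha⟩ ⟨ξ, hξ, hb⟩
        exact ⟨ζ * ξ, hζ.mul hξ, by rw [ofMul_mul, map_add, map_add, ha, hb]⟩
      neg_mem' := by
        rintro a ⟨ζ, hζ, ha⟩
        exact ⟨ζ⁻¹, hζ.inv, by rw [ofMul_inv, map_neg, map_neg, ha]⟩ }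
  smul_mem σ {m} := by
    rintro ⟨ζ, hζ, hm⟩
    have hιm : ((pointsMap W (v.adicCompletion K)).comp (W.geomPrimaryTorsion p).subtype)
        (absGaloisRestrict K (v.adicCompletion K) σ • m) = σ • Φ (Additive.ofMul ζ) := by
      rw [hm, AddMonoidHom.comp_apply, AddMonoidHom.comp_apply]
      exact pointsMap_smul W (v.adicCompletion K) σ (m : W.geomPoints)
    rcases hΦ σ ζ with h | h
    · exact ⟨_, (Units.map _).isOfFinOrder hζ, by rw [hιm, h]⟩
    · refine ⟨(Units.map (Field.absoluteGaloisGroup.toAlgEquiv (v.adicCompletion K) σ :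
          AlgebraicClosure (v.adicCompletion K) →* AlgebraicClosure (v.adicCompletion K)) ζ)⁻¹,
        ((Units.map _).isOfFinOrder hζ).inv, ?_⟩
      rw [hιm, h, ofMul_inv, map_neg]

variable {W p Φ} in
/-- Membership in the Tate datum. [cite: GreenbergVatsal2000, §2 pp. 14–15] -/
theorem mem_tateDatum_plus_iff
    (hΦ : ∀ (σ : absoluteGaloisGroup (v.adicCompletion K))
      (u : (AlgebraicClosure (v.adicCompletion K))ˣ),
      σ • Φ (Additive.ofMul u) = Φ (Additive.ofMul (Units.map
        (Field.absoluteGaloisGroup.toAlgEquiv (v.adicCompletion K) σ :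
          AlgebraicClosure (v.adicCompletion K) →* AlgebraicClosure (v.adicCompletion K)) u)) ∨
      σ • Φ (Additive.ofMul u) = -Φ (Additive.ofMul (Units.map
        (Field.absoluteGaloisGroup.toAlgEquiv (v.adicCompletion K) σ :
          AlgebraicClosure (v.adicCompletion K) →* AlgebraicClosure (v.adicCompletion K)) u)))
    (m : W.geomPrimaryTorsion p) :
    m ∈ (tateDatum W p Φ hΦ).plus ↔ ∃ ζ : (AlgebraicClosure (v.adicCompletion K))ˣ,
      IsOfFinOrder ζ ∧ Φ (Additive.ofMul ζ) = pointsMap W (v.adicCompletion K) (m : W.geomPoints) :=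
  Iff.rfl

end Datum

/-! ## §2. "`I_v` acts trivially on `D`" and the Kummer compatibility, from equivariance on inertia -/

section Local

variable [hp : Fact p.Prime]
variable
  (hΦ : ∀ (σ : absoluteGaloisGroup (v.adicCompletion K))
    (u : (AlgebraicClosure (v.adicCompletion K))ˣ),
    σ • Φ (Additive.ofMul u) = Φ (Additive.ofMul (Units.map
      (Field.absoluteGaloisGroup.toAlgEquiv (v.adicCompletion K) σ :
        AlgebraicClosure (v.adicCompletion K) →* AlgebraicClosure (v.adicCompletion K)) u)) ∨
    σ • Φ (Additive.ofMul u) = -Φ (Additive.ofMul (Units.map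
      (Field.absoluteGaloisGroup.toAlgEquiv (v.adicCompletion K) σ :
        AlgebraicClosure (v.adicCompletion K) →* AlgebraicClosure (v.adicCompletion K)) u)))
  (hsurj : Function.Surjective Φ) {q : v.adicCompletion K}
  (hker : ∀ u : (AlgebraicClosure (v.adicCompletion K))ˣ, Φ (Additive.ofMul u) = 0 →
    ∃ a : ℤ, (u : AlgebraicClosure (v.adicCompletion K)) =
      algebraMap (v.adicCompletion K) (AlgebraicClosure (v.adicCompletion K)) q ^ a)
  (hΦI : ∀ σ ∈ absInertia (v.adicCompletion K), ∀ u : (AlgebraicClosure (v.adicCompletion K))ˣ,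
    σ • Φ (Additive.ofMul u) = Φ (Additive.ofMul (Units.map
      (Field.absoluteGaloisGroup.toAlgEquiv (v.adicCompletion K) σ :
        AlgebraicClosure (v.adicCompletion K) →* AlgebraicClosure (v.adicCompletion K)) u)))

include hsurj hker hΦI in
/-- **GV's hypothesis "`I_p` acts trivially on `D = A/C`" HOLDS for the Tate datum** (`htriv` of the
comparison theorems): for `x ∈ I_v` and `m ∈ E[p^∞]`, `x•m - m ∈ C_v`. Proof: `ι m = Φ(u)` with
`u^{p^k} ∈ q^ℤ` (kernel `q^ℤ`); `x•(ι m) - ι m = Φ(σu/u)` (`Φ` equivariant on inertia) and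
`(σu/u)^{p^k} = σ(q^a)/q^a = 1` since `q ∈ K_v` — so `σu/u` is a root of unity. (In fact every
`σ ∈ Γ_{K_v}` with `σ•Φ(u) = Φ(σu)` works: `D ≅ ℚ_p/ℤ_p` is a trivial `G_{ℚ_p}`-module in the split
case, GV p. 14.) [cite: GreenbergVatsal2000, §2 pp. 14–15]
[cite: SilvermanATAEC1994, Ch. V Thm. 3.1 (c),(d)] -/
theorem tateDatum_htriv :
    ∀ x ∈ inertia v, ∀ m : W.geomPrimaryTorsion p, x • m - m ∈ (tateDatum W p Φ hΦ).plus := by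
  intro x hx m
  obtain ⟨σ, hσ, rfl⟩ := Subgroup.mem_map.1 hx
  obtain ⟨u, hu⟩ := hsurj (pointsMap W (v.adicCompletion K) (m : W.geomPoints))
  obtain ⟨u', rfl⟩ : ∃ u' : (AlgebraicClosure (v.adicCompletion K))ˣ, Additive.ofMul u' = u :=
    ⟨Additive.toMul u, ofMul_toMul u⟩
  obtain ⟨k, hk⟩ := (AddCommGroup.mem_primaryComponent).1 m.2
  have h0 : Φ (Additive.ofMul (u' ^ p ^ k)) = 0 := by
    rw [ofMul_pow, map_nsmul, hu, ← map_nsmul, hk, map_zero]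
  obtain ⟨a, ha⟩ := hker _ h0
  rw [mem_tateDatum_plus_iff]
  refine ⟨Units.map (Field.absoluteGaloisGroup.toAlgEquiv (v.adicCompletion K) σ :
      AlgebraicClosure (v.adicCompletion K) →* AlgebraicClosure (v.adicCompletion K)) u' * u'⁻¹,
    ?_, ?_⟩
  · refine isOfFinOrder_iff_pow_eq_one.2 ⟨p ^ k, pow_pos hp.out.pos k, ?_⟩
    rw [mul_pow, inv_pow, ← map_pow, mul_inv_eq_one]
    ext
    rw [Units.coe_map, MonoidHom.coe_coe, ha, map_zpow₀, AlgEquiv.commutes]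
  · rw [ofMul_mul, ofMul_inv, map_add, map_neg, ← hΦI σ hσ u', hu, AddSubgroupClass.coe_sub,
      map_sub, primaryComponent.coe_smul, ← sub_eq_add_neg]
    congr 1
    exact (pointsMap_smul W (v.adicCompletion K) σ (m : W.geomPoints)).symm

include hsurj hker hΦI in
/-- **The KUMMER COMPATIBILITY of the Tate datum** (hypothesis `hL` of
`GreenbergVatsalSelmerLink.selmerGroupOver_le_gvSelmer`): if `σP - P` (`σ ∈ I_{K_v}`, `P ∈ E(K̄_v)`
ARBITRARY) is a `p`-power torsion point, it lies in `C_v`. Proof: `P = Φ(u)`, `σP - P = Φ(σu/u)`;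
`(σu/u)^{p^k} = q^a` (kernel `q^ℤ`), and `|σu/u|_v = 1` (`Γ_{K_v}` acts by isometries for the
spectral valuation) while `|q|_v < 1`, so `a = 0` and `σu/u ∈ μ_{p^k}`. This is the `p ‖ N` analogue
of Greenberg's `im(κ_p) ⊆ L_p` (GV pp. 14–15: `Sel_E(ℚ_∞)_p ⊆ S_A(ℚ_∞)`, corank difference `e_p`).
[cite: GreenbergVatsal2000, §2 pp. 14–15] [cite: SilvermanATAEC1994, Ch. V Thm. 3.1 (c),(d)] -/
theorem tateDatum_kummer (hq0 : q ≠ 0) (hq1 : Valued.v q < 1) :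
    ∀ σ ∈ absInertia (v.adicCompletion K), ∀ (P : localPoints W (v.adicCompletion K))
      (m : W.geomPrimaryTorsion p),
      pointsMap W (v.adicCompletion K) (m : W.geomPoints) = σ • P - P →
        m ∈ (tateDatum W p Φ hΦ).plus := by
  intro σ hσ P m hm
  obtain ⟨u, rfl⟩ := hsurj P
  obtain ⟨u', rfl⟩ : ∃ u' : (AlgebraicClosure (v.adicCompletion K))ˣ, Additive.ofMul u' = u :=
    ⟨Additive.toMul u, ofMul_toMul u⟩
  obtain ⟨k, hk⟩ := (AddCommGroup.mem_primaryComponent).1 m.2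
  set ζ : (AlgebraicClosure (v.adicCompletion K))ˣ :=
    Units.map (Field.absoluteGaloisGroup.toAlgEquiv (v.adicCompletion K) σ :
      AlgebraicClosure (v.adicCompletion K) →* AlgebraicClosure (v.adicCompletion K)) u' * u'⁻¹
    with hζdef
  have hζΦ : Φ (Additive.ofMul ζ) = pointsMap W (v.adicCompletion K) (m : W.geomPoints) := by
    rw [hm, hζdef, ofMul_mul, ofMul_inv, map_add, map_neg, ← hΦI σ hσ u', sub_eq_add_neg]
  have h0 : Φ (Additive.ofMul (ζ ^ p ^ k)) = 0 := by
    rw [ofMul_pow, map_nsmul, hζΦ, ← map_nsmul, hk, map_zero]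
  obtain ⟨a, ha⟩ := hker _ h0
  -- valuation: `|ζ|_v = 1`, `|q|_v < 1` force `a = 0`
  obtain ⟨w, hw⟩ := v.exists_spectralValuation
  have hu0 : w (u' : AlgebraicClosure (v.adicCompletion K)) ≠ 0 := (map_ne_zero w).2 u'.ne_zero
  have hwζ : w (ζ : AlgebraicClosure (v.adicCompletion K)) = 1 := by
    rw [hζdef, Units.val_mul, map_mul, Units.coe_map, MonoidHom.coe_coe,
      ← Field.absoluteGaloisGroup.smul_def, spectralValuation_smul hw, Units.val_inv_eq_inv_val,
      map_inv₀, mul_inv_cancel₀ hu0]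
  have hq' : algebraMap (v.adicCompletion K) (AlgebraicClosure (v.adicCompletion K)) q ≠ 0 :=
    (map_ne_zero_iff _ (algebraMap (v.adicCompletion K)
      (AlgebraicClosure (v.adicCompletion K))).injective).2 hq0
  have hwq0 : 0 < w (algebraMap (v.adicCompletion K) (AlgebraicClosure (v.adicCompletion K)) q) :=
    zero_lt_iff.2 ((map_ne_zero w).2 hq')
  have hwq : w (algebraMap (v.adicCompletion K) (AlgebraicClosure (v.adicCompletion K)) q) < 1 := by
    rw [← NNReal.coe_lt_coe, coe_spectralValuation_algebraMap hw, NNReal.coe_one]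
    exact Valued.toNormedField.norm_lt_one_iff.mpr hq1
  have hpow : w (algebraMap (v.adicCompletion K) (AlgebraicClosure (v.adicCompletion K)) q) ^ a =
      w (algebraMap (v.adicCompletion K) (AlgebraicClosure (v.adicCompletion K)) q) ^ (0 : ℤ) := by
    rw [zpow_zero, ← map_zpow₀, ← ha, Units.val_pow_eq_pow_val, map_pow, hwζ, one_pow]
  have ha0 : a = 0 := (zpow_right_strictAnti₀ hwq0 hwq).injective hpow
  rw [ha0, zpow_zero] at ha
  rw [mem_tateDatum_plus_iff]
  exact ⟨ζ, isOfFinOrder_iff_pow_eq_one.2 ⟨p ^ k, pow_pos hp.out.pos k, Units.ext ha⟩, hζΦ⟩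

end Local

/-! ## §3. From the tree's Tate-uniformisation facts (Silverman *ATAEC* V.3.1/V.5.3/V.5.4) -/

section Facts

variable [W.IsElliptic] [Fact p.Prime]

/-- **At a SPLIT multiplicative place, a Greenberg datum with GV's two hypotheses DISCHARGED
exists**, granted the tree's named fact `Silverman1994_thmV53_tateUniformisation` (Silverman *ATAEC*
V.5.3 (a),(b) + V.3.1 (c),(d), PUBLISHED; taken as the hypothesis `hT`): the Tate datum of the
parametrisation `Φ` it provides satisfies `htriv` and the Kummer compatibility.
[cite: SilvermanATAEC1994, Ch. V Thm. 3.1 (c),(d) p. 423 and §V.5 Thm. 5.3 (a),(b)]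
[cite: GreenbergVatsal2000, §2 pp. 14–15] -/
theorem exists_datum_of_hasSplitMultiplicativeReductionAt
    (hT : Silverman1994_thmV53_tateUniformisation.{u}) (hv : W.HasSplitMultiplicativeReductionAt v) :
    ∃ N : LocalDatum K (W.geomPrimaryTorsion p) v,
      (∀ x ∈ inertia v, ∀ m : W.geomPrimaryTorsion p, x • m - m ∈ N.plus) ∧
      (∀ σ ∈ absInertia (v.adicCompletion K), ∀ (P : localPoints W (v.adicCompletion K))
        (m : W.geomPrimaryTorsion p),
        pointsMap W (v.adicCompletion K) (m : W.geomPoints) = σ • P - P → m ∈ N.plus) := by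
  obtain ⟨q, Φ, hq0, hq1, hsurj, hker, hΦσ, -⟩ := hT W v hv
  exact ⟨tateDatum W p Φ (fun σ u ↦ Or.inl (hΦσ σ u)),
    tateDatum_htriv W p Φ _ hsurj (fun u h ↦ (hker u).1 h) (fun σ _ u ↦ hΦσ σ u),
    tateDatum_kummer W p Φ _ hsurj (fun u h ↦ (hker u).1 h) (fun σ _ u ↦ hΦσ σ u) hq0 hq1⟩

/-- **At a multiplicative place, split OR NON-SPLIT, the same holds granted the twisted
uniformisation** `Silverman1994_thmV53_corV54_tateUniformisation` (Silverman *ATAEC* Lemma V.5.2 (c),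
Thm. V.5.3, Cor. V.5.4; hypothesis `hT`) **and that the local inertia group fixes `t = √γ(E/K)`**
(`ht`: automatic in the split case, `t ∈ K_v`; in the non-split case it says `K_v(t)/K_v` is the
UNRAMIFIED quadratic extension — Silverman *ATAEC* Ex. 5.11, true at a multiplicative place of odd
residue characteristic since `γ` of a minimal equation is a `v`-unit; displayed here, not proved).
[cite: SilvermanATAEC1994, Ch. V Lemma 5.2 (c), Thm. 5.3 (a),(b), Cor. 5.4 (held copy PDF pp. 406–410)]
[cite: GreenbergVatsal2000, §2 pp. 14–15] -/
theorem exists_datum_of_hasMultiplicativeReductionAt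
    (hT : Silverman1994_thmV53_corV54_tateUniformisation.{u}) (hv : W.HasMultiplicativeReductionAt v)
    (ht : ∀ t : AlgebraicClosure (v.adicCompletion K),
      t ^ 2 = algebraMap (v.adicCompletion K) (AlgebraicClosure (v.adicCompletion K))
        (algebraMap K (v.adicCompletion K) (-(W.c₄ / W.c₆))) →
      ∀ σ ∈ absInertia (v.adicCompletion K),
        Field.absoluteGaloisGroup.toAlgEquiv (v.adicCompletion K) σ t = t) :
    ∃ N : LocalDatum K (W.geomPrimaryTorsion p) v,
      (∀ x ∈ inertia v, ∀ m : W.geomPrimaryTorsion p, x • m - m ∈ N.plus) ∧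
      (∀ σ ∈ absInertia (v.adicCompletion K), ∀ (P : localPoints W (v.adicCompletion K))
        (m : W.geomPrimaryTorsion p),
        pointsMap W (v.adicCompletion K) (m : W.geomPoints) = σ • P - P → m ∈ N.plus) := by
  obtain ⟨q, t, Ψ, hq0, hq1, -, ht2, hsurj, hker, hΨσ, -⟩ := hT W v hv
  have hΨ : ∀ (σ : absoluteGaloisGroup (v.adicCompletion K))
      (u : (AlgebraicClosure (v.adicCompletion K))ˣ),
      σ • Ψ (Additive.ofMul u) = Ψ (Additive.ofMul (Units.map
        (Field.absoluteGaloisGroup.toAlgEquiv (v.adicCompletion K) σ :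
          AlgebraicClosure (v.adicCompletion K) →* AlgebraicClosure (v.adicCompletion K)) u)) ∨
      σ • Ψ (Additive.ofMul u) = -Ψ (Additive.ofMul (Units.map
        (Field.absoluteGaloisGroup.toAlgEquiv (v.adicCompletion K) σ :
          AlgebraicClosure (v.adicCompletion K) →* AlgebraicClosure (v.adicCompletion K)) u)) := by
    intro σ u
    rw [hΨσ σ u]
    split_ifs
    · exact Or.inl (one_zsmul _)
    · exact Or.inr (neg_one_zsmul _)
  have hΨI : ∀ σ ∈ absInertia (v.adicCompletion K),
      ∀ u : (AlgebraicClosure (v.adicCompletion K))ˣ,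
      σ • Ψ (Additive.ofMul u) = Ψ (Additive.ofMul (Units.map
        (Field.absoluteGaloisGroup.toAlgEquiv (v.adicCompletion K) σ :
          AlgebraicClosure (v.adicCompletion K) →* AlgebraicClosure (v.adicCompletion K)) u)) := by
    intro σ hσ u
    rw [hΨσ σ u, if_pos (ht t ht2 σ hσ), one_zsmul]
  exact ⟨tateDatum W p Ψ hΨ, tateDatum_htriv W p Ψ hΨ hsurj (fun u h ↦ (hker u).1 h) hΨI,
    tateDatum_kummer W p Ψ hΨ hsurj (fun u h ↦ (hker u).1 h) hΨI hq0 hq1⟩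

end Facts

/-! ## §4. The link at multiplicative places: `Sel_{p^∞}(E/L) ⊆ S^{Σ₀}_{E[p^∞]}(L)` with Tate data -/

section Link

variable [W.IsElliptic] [Fact p.Prime] (H : Subgroup (absoluteGaloisGroup K)) [H.Normal]
  (S₀ : Set (HeightOneSpectrum (𝓞 K)))

/-- **`Sel_{p^∞}(E/L) ⊆ S^{Σ₀}_{E[p^∞]}(L)` when `E` has SPLIT multiplicative reduction at every
`v ∣ p`** (e.g. `E/ℚ` with `p ‖ N` split — the X2 member of a route-G pair with `e_p = 1`), for
Tate data satisfying GV's `htriv`, and every `Σ₀ ⊇` bad places prime to `p`; granted the PUBLISHED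
Tate uniformisation (`hT`). [cite: GreenbergVatsal2000, §2 p. 19 (6) and pp. 14–15]
[cite: SilvermanATAEC1994, Ch. V Thm. 3.1 (c),(d) and Thm. 5.3 (a),(b)] -/
theorem exists_data_selmerGroupOver_le_gvSelmer_of_split
    (hT : Silverman1994_thmV53_tateUniformisation.{u})
    (hS : ∀ v : HeightOneSpectrum (𝓞 K), v ∉ S₀ → ((p : ℕ) : 𝓞 K) ∉ v.asIdeal →
      W.HasGoodReductionAt v)
    (hmult : ∀ (v : HeightOneSpectrum (𝓞 K)), ((p : ℕ) : 𝓞 K) ∈ v.asIdeal →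
      W.HasSplitMultiplicativeReductionAt v) :
    ∃ L : Data K (W.geomPrimaryTorsion p) p,
      (∀ (v : HeightOneSpectrum (𝓞 K)) (hv : ((p : ℕ) : 𝓞 K) ∈ v.asIdeal),
        ∀ x ∈ inertia v, ∀ m : W.geomPrimaryTorsion p, x • m - m ∈ (L v hv).plus) ∧
      W.selmerGroupOver p H ≤ gvSelmer H (W.geomPrimaryTorsion p) p L S₀ := by
  choose N hN₁ hN₂ using fun (v : HeightOneSpectrum (𝓞 K)) (hv : ((p : ℕ) : 𝓞 K) ∈ v.asIdeal) ↦
    exists_datum_of_hasSplitMultiplicativeReductionAt W p hT (hmult v hv)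
  exact ⟨N, hN₁, GreenbergVatsalSelmerLink.selmerGroupOver_le_gvSelmer W p H N S₀ hS hN₂⟩

/-- The same over the top of a `ℤ_p`-extension: **`WeierstrassCurve.selmerInfty κ ≤ gvSelmerInfty κ
E[p^∞] L Σ₀` for Tate data `L` with `htriv`** — the dual link (referee R102.2 (b)) for the
MULTIPLICATIVE member of a route-G pair at `p ‖ N` (split), conditional only on the published Tate
uniformisation. [cite: GreenbergVatsal2000, §2 p. 19 (6) and pp. 14–15]
[cite: SilvermanATAEC1994, Ch. V Thm. 3.1 (c),(d) and Thm. 5.3 (a),(b)] -/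
theorem exists_data_selmerInfty_le_gvSelmerInfty_of_split (κ : ZpExtension K p)
    (hT : Silverman1994_thmV53_tateUniformisation.{u})
    (hS : ∀ v : HeightOneSpectrum (𝓞 K), v ∉ S₀ → ((p : ℕ) : 𝓞 K) ∉ v.asIdeal →
      W.HasGoodReductionAt v)
    (hmult : ∀ (v : HeightOneSpectrum (𝓞 K)), ((p : ℕ) : 𝓞 K) ∈ v.asIdeal →
      W.HasSplitMultiplicativeReductionAt v) :
    ∃ L : Data K (W.geomPrimaryTorsion p) p,
      (∀ (v : HeightOneSpectrum (𝓞 K)) (hv : ((p : ℕ) : 𝓞 K) ∈ v.asIdeal),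
        ∀ x ∈ inertia v, ∀ m : W.geomPrimaryTorsion p, x • m - m ∈ (L v hv).plus) ∧
      W.selmerInfty κ ≤ gvSelmerInfty κ (W.geomPrimaryTorsion p) L S₀ :=
  exists_data_selmerGroupOver_le_gvSelmer_of_split W p κ.kerSubgroup S₀ hT hS hmult

/-- **Split or non-split**: the same granted the twisted uniformisation (`hT`) and that inertia
fixes `√γ(E/K)` at every `v ∣ p` (`ht`, see `exists_datum_of_hasMultiplicativeReductionAt`).
[cite: GreenbergVatsal2000, §2 p. 19 (6) and pp. 14–15]
[cite: SilvermanATAEC1994, Ch. V Lemma 5.2 (c), Thm. 5.3 (a),(b), Cor. 5.4 (held copy PDF pp. 406–410)] -/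
theorem exists_data_selmerInfty_le_gvSelmerInfty_of_multiplicative (κ : ZpExtension K p)
    (hT : Silverman1994_thmV53_corV54_tateUniformisation.{u})
    (hS : ∀ v : HeightOneSpectrum (𝓞 K), v ∉ S₀ → ((p : ℕ) : 𝓞 K) ∉ v.asIdeal →
      W.HasGoodReductionAt v)
    (hmult : ∀ (v : HeightOneSpectrum (𝓞 K)), ((p : ℕ) : 𝓞 K) ∈ v.asIdeal →
      W.HasMultiplicativeReductionAt v)
    (ht : ∀ (v : HeightOneSpectrum (𝓞 K)), ((p : ℕ) : 𝓞 K) ∈ v.asIdeal →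
      ∀ t : AlgebraicClosure (v.adicCompletion K),
        t ^ 2 = algebraMap (v.adicCompletion K) (AlgebraicClosure (v.adicCompletion K))
          (algebraMap K (v.adicCompletion K) (-(W.c₄ / W.c₆))) →
        ∀ σ ∈ absInertia (v.adicCompletion K),
          Field.absoluteGaloisGroup.toAlgEquiv (v.adicCompletion K) σ t = t) :
    ∃ L : Data K (W.geomPrimaryTorsion p) p,
      (∀ (v : HeightOneSpectrum (𝓞 K)) (hv : ((p : ℕ) : 𝓞 K) ∈ v.asIdeal),
        ∀ x ∈ inertia v, ∀ m : W.geomPrimaryTorsion p, x • m - m ∈ (L v hv).plus) ∧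
      W.selmerInfty κ ≤ gvSelmerInfty κ (W.geomPrimaryTorsion p) L S₀ := by
  choose N hN₁ hN₂ using fun (v : HeightOneSpectrum (𝓞 K)) (hv : ((p : ℕ) : 𝓞 K) ∈ v.asIdeal) ↦
    exists_datum_of_hasMultiplicativeReductionAt W p hT (hmult v hv) (ht v hv)
  exact ⟨N, hN₁,
    GreenbergVatsalSelmerLink.selmerInfty_le_gvSelmerInfty W p N S₀ κ hS hN₂⟩

end Link

end Summit.BirchSwinnertonDyer.Rank1Residual.X2.GreenbergVatsalTateDatum

end
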